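import Mathlib.Data.Matrix.PEquiv
import Mathlib.LinearAlgebra.Matrix.Block
import Literature.NumberTheory.GaloisRepresentations.OrdinaryGaloisRep
import HarnessLib

/-!
# `p`-distinguished weight-2 ordinary representations `Γ_{K_v} → GL₄(ℚ̄_p)` (Boxer–Calegari–Gee–Pilloni)

Topic `Literature/NumberTheory/GaloisRepresentations`; definition request
`defn-IsWeightTwoOrdinaryDistinguishedAt` of route `Summits/Langlands/Langlands/Theses/PhantomRM.lean`
(items `PhantomRMSector`, `ResiduallyYoshidaLifting`, `StableYoshidaCongruence`, which inline a
local condition at `v ∣ p` on a framed `ρ : Γ_ℚ → GL₄(ℚ̄_p)`).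

## The printed definition and its translation

Boxer–Calegari–Gee–Pilloni [BoxerEtAl2021, §7.3, Def. 7.3.1 — the first definition of §7.3] work
with `ρ_{A,p} = H¹_ét(A_{F̄}, ℚ_p)`, the DUAL of the `p`-adic Tate module of an abelian surface `A`
(loc. cit. §9.2: "the compatible system `{H¹(A_{F̄}, ℚ_l)}`"), valued in `GSp₄` for the
antidiagonal form `J` of §2.1.1 with similitude character `ε⁻¹` (`ε` the `p`-adic cyclotomic
character).  For `v ∣ p` and `x` a unit they write `λ_x : G_{F_v} → k^×` (`𝒪^×`) for the UNRAMIFIED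
character with `λ_x(Frob_v) = x`, and define: `ρ̄|_{G_{F_v}}` is **`p`-distinguished weight 2
ordinary** if it is conjugate to
```
  ⎛ λ_ᾱ   0    *        *      ⎞
  ⎜ 0    λ_β̄   *        *      ⎟        with  ᾱ ≠ β̄ ,
  ⎜ 0    0    ε̄⁻¹λ_β̄⁻¹  0      ⎟
  ⎝ 0    0    0        ε̄⁻¹λ_ᾱ⁻¹⎠
```
and a lift `ρ : G_{F_v} → GSp₄(𝒪)` is `p`-distinguished weight 2 ordinary if `ρ` ITSELF is conjugate
to the same shape with unramified `λ_α, λ_β`, `α, β` lifting `ᾱ ≠ β̄` ("Note that `ρ` is then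
automatically semistable, although not necessarily crystalline"; Remark 7.3.2: "semistable
ordinary" / "`P`-ordinary" for the Siegel parabolic `P` would be other names).  Loc. cit. §7.3
then names the two shapes: `B`-ordinary = upper triangular (Borel), `P`-ordinary = upper
triangular WITH the two zeros at positions `(1,2)` and `(3,4)`, "equivalently both
`(B, ᾱ)`- and `(B, β̄)`-ordinary".

The requesting route uses the HOMOLOGICAL convention: `ρ ≈ V_p(A) = ρ_{A,p}^∨`, symplectic with
multiplier `ε`.  Dualising the displayed matrix `M(τ)` and reversing the basis (`e₃*, e₂*, e₁*,
e₀*`), `N(τ) = w (M(τ)⁻¹)ᵀ w` is again upper triangular, again has zeros at `(1,2)` and `(3,4)`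
(the diagonal `2 × 2` blocks of `M` are diagonal, hence so are those of `M⁻¹`), and has diagonal
`N_{ii} = 1 / M_{5-i,5-i}`:
```
  ⎛ ε·λ_α  0      *      *    ⎞
  ⎜ 0      ε·λ_β  *      *    ⎟ ,      λ_α, λ_β unramified,  ᾱ ≠ β̄ .          (P)
  ⎜ 0      0      λ_β⁻¹  0    ⎟
  ⎝ 0      0      0      λ_α⁻¹⎠
```
`FramedGaloisRep.IsWeightTwoOrdinaryDistinguished ρ` (local, `ρ : Γ_F → GL₄(ℚ̄_p)`, `F` a
non-archimedean local field) says exactly: for some frame `g ∈ GL₄(ℚ̄_p)` and some characters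
`α, β : Γ_F →* ℚ̄_p^×` trivial on the inertia group `I_F` (accepted `absInertia F`) and
RESIDUALLY DISTINCT (`‖α(τ) - β(τ)‖ = 1` for some `τ`, i.e. `ᾱ ≠ β̄` as characters to `𝔽̄_p^×` —
for unramified `α, β` this is `ᾱ(Frob) ≠ β̄(Frob)`), every `g⁻¹ ρ(τ) g` has the shape (P) with
`λ_α = α`, `λ_β = β` and `ε = GaloisRep.cyclotomicCharacter F p` read in `ℚ̄_p` along
`ℤ_p ⊆ ℚ_p → ℚ̄_p`.  `FramedGaloisRep.IsWeightTwoOrdinaryDistinguishedAt ρ v` (global, `K` a number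
field, `v` a finite place, intended `v ∣ p`) is the local predicate for `ρ.toLocal v` (accepted
`FramedGaloisRep.toLocal`, local-field structure on `K_v` from `AdicCompletionLocalField`).

## The route's inline clause is the BOREL shape (design note for the planner)

The sub-formula inlined in the three PhantomRM items is (P) WITHOUT the two zero conditions
`N₁₂ = N₃₄ = 0` — the `B`-ordinary shape of loc. cit.  That clause is STRICTLY WEAKER and is not
the cited notion: with `α ≠ β` residually, `H¹(G_{ℚ_p}, ℚ̄_p(αβ⁻¹))` is one-dimensional (local
Euler characteristic) while its unramified part vanishes, so there are Borel-shaped `ρ` whose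
`Γ`-stable plane `⟨e₀, e₁⟩` is a NON-SPLIT (ramified) extension of `εβ` by `εα`; such a `ρ` has a
`2`-dimensional subquotient of Hodge–Tate weight `(1,1)` on which inertia acts through an infinite
unipotent group, so it is not de Rham, and it is not conjugate to (P) (the semisimplification is
multiplicity free, and (P) contains the subrepresentation `εα ⊕ εβ`).  Boxer–Calegari–Gee–Pilloni's
"automatically semistable" (and the request's "ordinary of this shape ⇒ semistable ⇒ de Rham with
Hodge–Tate weights `{0,0,1,1}`") holds for (P), not for the Borel shape.  This file therefore
vendors (P), faithful to the source; `IsWeightTwoOrdinaryDistinguished.exists_borel` records that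
(P) implies the route's Borel clause verbatim (so an item restated through the definition has a
STRONGER hypothesis than the inline original, and follows from it).  For a `ρ` that is symplectic
with multiplier `ε` the zero at `(1,2)` already forces a symplectic frame of shape (P) (the plane
`εα ⊕ εβ` is Lagrangian by weights), so (P) up to `GL₄`-conjugacy, as here, matches the source's
`GSp₄`-conjugacy in the route's setting; this remark is not used and not formalised.

## Contents (all proved; no named fact is introduced)

* `FramedGaloisRep.IsWeightTwoOrdinaryDistinguished ρ`, `FramedGaloisRep.IsWeightTwoOrdinaryDistinguishedAt ρ v`;
* `isWeightTwoOrdinaryDistinguishedAt_iff` — the unfolding in the binder order of the route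
  (`∃ g α β, unramified ∧ residually distinct ∧ ∀ τ, shape of g⁻¹ (ρ.toLocal v τ) g`);
* frame invariance `isWeightTwoOrdinaryDistinguished_conj_iff`, `isWeightTwoOrdinaryDistinguishedAt_conj_iff`
  (accepted `FramedRep.conj`, `FramedGaloisRep.toLocal_conj`);
* `IsWeightTwoOrdinaryDistinguished.exists_borel`, `IsWeightTwoOrdinaryDistinguishedAt.exists_borel` — (P) ⇒ the
  route's Borel clause;
* `IsWeightTwoOrdinaryDistinguished.coe_det_apply` — the determinant of such a `ρ` is `ε²`
  (`= ν²` for multiplier `ν = ε`, consistent with the homological convention);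
* `IsWeightTwoOrdinaryDistinguished.dual_of_cohomological` — the FAITHFULNESS CERTIFICATE for the
  translation above: if `ρ'` has the printed (cohomological) shape in some frame, then its
  contragredient `FramedRep.dual ρ'` satisfies the predicate defined here (frame `(gᵀ)⁻¹ w`).

## Design choices

* Coefficients `ℚ̄_p = PadicAlgCl p` (Mathlib), as in the route; residual distinctness is phrased
  with Mathlib's `Valued (PadicAlgCl p) ℝ≥0` (`Valued.v x = ‖x‖₊`), verbatim the route's clause.  The
  source's `𝒪`-valued lifts give `ℚ̄_p`-valued ones by extension of scalars; no integrality is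
  imposed here (for continuous `ρ` the diagonal characters are automatically continuous and
  valued in `𝒪_{ℚ̄_p}^×`, `Γ_F` being compact — not needed, not proved).
* `α, β` are bare monoid homomorphisms `Γ_F →* ℚ̄_p^×` and the frame is written `g⁻¹ ρ(τ) g` with
  `Matrix.GeneralLinearGroup` and `.val i j` entries — the primitive vocabulary of the route, so
  that restating its items is syntactic.  Rank `4` and weight `2` only (the source's generality);
  a weight-general / rank-general parabolic-ordinary predicate is the accepted
  `FramedGaloisRep.IsPOrdinary` (`POrdinaryGaloisRep.lean`, needs a local Artin datum) and the
  Borel version with cyclotomic diagonal is the accepted `FramedRep.IsCrystallineOrdinary`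
  (`CrystallineOrdinary.lean`, pairwise DISTINCT exponents — there the Borel shape is Greenberg-ordinary;
  here the exponents `(1,1,0,0)` repeat, which is exactly why the two zeros matter).
* The definition does not demand `v ∣ p` (the route quantifies `∀ v, p ∈ v → …`), nor
  symplecticity (a separate clause of the route, accepted `FramedGaloisRep.IsSymplecticWithMultiplier`).
* NOT here: semistability / de Rhamness of (P) (Perrin-Riou; the tree has no `B_st`), the
  equivalence with the `GSp₄`-conjugacy formulation, existence of `𝒪`-models, and any statement
  about abelian surfaces (the criterion `p ∤ a₁² - 4a₂` in the proof of loc. cit. Lemma 9.2.5).  No non-vacuity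
  `example` is shipped: an instance needs an unramified character of `Γ_F` with prescribed
  Frobenius value mod `p` (e.g. the unramified quadratic character), which the tree only has
  through named facts (`LocalGaloisGroup.exists_isAbsArithFrob` etc.); the proved API is the
  sanity check.

## References

* G. Boxer, F. Calegari, T. Gee, V. Pilloni, *Abelian surfaces over totally real fields are
  potentially modular*, Publ. Math. IHÉS 134 (2021), 153–501: §2.1.1 (`GSp₄`, `J`, `ν`), §7.3
  Definition 7.3.1 and Remark 7.3.2 (`p`-distinguished weight 2 ordinary; `B`- and `P`-ordinary
  lifts; the first two numbered items of §7.3), §1 (the shape of `ρ_{A,p}|_{G_{ℚ_p}}` for good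
  ordinary reduction), §9.2 (`ρ_{A,l} = H¹(A_{F̄}, ℚ_l)`; Definition 9.2.3: good primes; Lemma 9.2.5:
  density one, with the criterion `p ∤ a₁² - 4a₂` in its proof).  Numbering as in the published
  version / arXiv v3 (three-level, shared counter). [BoxerEtAl2021]
* G. Boxer, F. Calegari, T. Gee, V. Pilloni, *Modularity theorems for abelian surfaces*
  (arXiv:2502.20645, 2025), §1.8.8 (Definition: ordinary `GSp₄`-valued `ρ`, `p`-stabilisation
  `(χ₁, χ₂)`, `p`-distinguished, "semistable of weight 2" = the subrepresentation `(χ₁ * ; 0 χ₂)` is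
  unramified). [BoxerCalegariGeePilloni2025]
* B. Perrin-Riou, *Représentations p-adiques ordinaires*, Astérisque 223 (1994) (ordinary ⇒
  semistable; context only). [PerrinRiou1994Ordinaires]
-/

noncomputable section

open scoped NumberField MatrixGroups Matrix
open Field IsDedekindDomain

namespace Literature.NumberTheory.GaloisRepresentations

/-! ### The local predicate -/

section Local

variable {F : Type*} [Field F] [ValuativeRel F] [TopologicalSpace F] [IsNonarchimedeanLocalField F]
variable {p : ℕ} [Fact p.Prime]

namespace FramedGaloisRep

/-- **`ρ : Γ_F → GL₄(ℚ̄_p)` is `p`-distinguished weight-2 ordinary** (Boxer–Calegari–Gee–Pilloni,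
homological convention; `F` a non-archimedean local field, intended `F = K_v`, `v ∣ p`): there are
a frame `g ∈ GL₄(ℚ̄_p)` and characters `α, β : Γ_F →* ℚ̄_p^×` which are UNRAMIFIED (trivial on the
inertia group `I_F = absInertia F`) and RESIDUALLY DISTINCT (`‖α(τ) - β(τ)‖ = 1` for some `τ`,
i.e. `ᾱ ≠ β̄`) such that for every `τ ∈ Γ_F` the matrix `g⁻¹ ρ(τ) g` is upper triangular, its
entries `(1,2)` and `(3,4)` vanish as well (block upper triangular for `4 = 2 + 2` with DIAGONAL
diagonal blocks — the Siegel-parabolic "`P`-ordinary" shape, not merely Borel), and its diagonal is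
`(ε(τ)α(τ), ε(τ)β(τ), β(τ)⁻¹, α(τ)⁻¹)`, `ε = GaloisRep.cyclotomicCharacter F p` read in `ℚ̄_p`
along `ℤ_p ⊆ ℚ_p → ℚ̄_p`.  This is the printed definition (for `ρ_{A,p} = H¹`, similitude `ε⁻¹`:
conjugate to `(λ_α, 0, *, *; 0, λ_β, *, *; 0, 0, ε⁻¹λ_β⁻¹, 0; 0, 0, 0, ε⁻¹λ_α⁻¹)`, `λ_α, λ_β`
unramified lifting `ᾱ ≠ β̄`) transported to the contragredient `ρ_{A,p}^∨ ≅ V_p(A)` in the reversed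
dual basis (module docstring).  Such a `ρ` is semistable of Hodge–Tate weights `{0,0,1,1}`, not
necessarily crystalline (loc. cit.); dropping the two zero conditions gives the strictly weaker
Borel clause (`exists_borel`).
[cite: BoxerEtAl2021, §7.3, Definition 7.3.1 (p-distinguished weight 2 ordinary; lifts); Remark 7.3.2] -/
def IsWeightTwoOrdinaryDistinguished (ρ : FramedGaloisRep F (PadicAlgCl p) 4) : Prop :=
  ∃ (g : Matrix.GeneralLinearGroup (Fin 4) (PadicAlgCl p))
    (α β : absoluteGaloisGroup F →* (PadicAlgCl p)ˣ),
    (∀ τ ∈ absInertia F, α τ = 1 ∧ β τ = 1) ∧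
    (∃ τ, Valued.v ((α τ : PadicAlgCl p) - β τ) = 1) ∧
    ∀ τ, (∀ i j : Fin 4, j < i → (g⁻¹ * ρ τ * g).val i j = 0) ∧
      (g⁻¹ * ρ τ * g).val 0 1 = 0 ∧ (g⁻¹ * ρ τ * g).val 2 3 = 0 ∧
      (g⁻¹ * ρ τ * g).val 0 0 =
        algebraMap ℚ_[p] (PadicAlgCl p)
          (((GaloisRep.cyclotomicCharacter F p τ : ℤ_[p]ˣ) : ℤ_[p]) : ℚ_[p]) * α τ ∧
      (g⁻¹ * ρ τ * g).val 1 1 =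
        algebraMap ℚ_[p] (PadicAlgCl p)
          (((GaloisRep.cyclotomicCharacter F p τ : ℤ_[p]ˣ) : ℤ_[p]) : ℚ_[p]) * β τ ∧
      (g⁻¹ * ρ τ * g).val 2 2 = ((β τ)⁻¹ : (PadicAlgCl p)ˣ) ∧
      (g⁻¹ * ρ τ * g).val 3 3 = ((α τ)⁻¹ : (PadicAlgCl p)ˣ)

/-- `p`-distinguished weight-2 ordinarity does not depend on the frame: `P ρ P⁻¹`
(`FramedRep.conj`) satisfies it iff `ρ` does (frame `g` replaced by `P g`, resp. `P⁻¹ g`).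
[folklore] -/
theorem isWeightTwoOrdinaryDistinguished_conj_iff (P : GL (Fin 4) (PadicAlgCl p))
    (ρ : FramedGaloisRep F (PadicAlgCl p) 4) :
    IsWeightTwoOrdinaryDistinguished (FramedRep.conj P ρ) ↔ IsWeightTwoOrdinaryDistinguished ρ := by
  constructor
  · rintro ⟨g, α, β, hur, hdist, hsh⟩
    refine ⟨P⁻¹ * g, α, β, hur, hdist, fun τ => ?_⟩
    have e : (P⁻¹ * g)⁻¹ * ρ τ * (P⁻¹ * g) = g⁻¹ * FramedRep.conj P ρ τ * g := by
      rw [FramedRep.conj_apply]; group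
    rw [e]
    exact hsh τ
  · rintro ⟨g, α, β, hur, hdist, hsh⟩
    refine ⟨P * g, α, β, hur, hdist, fun τ => ?_⟩
    have e : (P * g)⁻¹ * FramedRep.conj P ρ τ * (P * g) = g⁻¹ * ρ τ * g := by
      rw [FramedRep.conj_apply]; group
    rw [e]
    exact hsh τ

/-- (P) implies the Borel clause: forgetting the two zero conditions at `(1,2)` and `(3,4)` leaves
exactly the sub-formula inlined (for `ρ = r.toLocal v`) in the items of route PhantomRM —
"`g⁻¹ ρ g` upper triangular with diagonal `(εα, εβ, β⁻¹, α⁻¹)`, `α, β` unramified and residually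
distinct".  The converse fails (module docstring). [folklore] -/
theorem IsWeightTwoOrdinaryDistinguished.exists_borel {ρ : FramedGaloisRep F (PadicAlgCl p) 4}
    (h : IsWeightTwoOrdinaryDistinguished ρ) :
    ∃ (g : Matrix.GeneralLinearGroup (Fin 4) (PadicAlgCl p))
      (α β : absoluteGaloisGroup F →* (PadicAlgCl p)ˣ),
      (∀ τ ∈ absInertia F, α τ = 1 ∧ β τ = 1) ∧
      (∃ τ, Valued.v ((α τ : PadicAlgCl p) - β τ) = 1) ∧
      ∀ τ, (∀ i j : Fin 4, j < i → (g⁻¹ * ρ τ * g).val i j = 0) ∧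
        (g⁻¹ * ρ τ * g).val 0 0 =
          algebraMap ℚ_[p] (PadicAlgCl p)
            (((GaloisRep.cyclotomicCharacter F p τ : ℤ_[p]ˣ) : ℤ_[p]) : ℚ_[p]) * α τ ∧
        (g⁻¹ * ρ τ * g).val 1 1 =
          algebraMap ℚ_[p] (PadicAlgCl p)
            (((GaloisRep.cyclotomicCharacter F p τ : ℤ_[p]ˣ) : ℤ_[p]) : ℚ_[p]) * β τ ∧
        (g⁻¹ * ρ τ * g).val 2 2 = ((β τ)⁻¹ : (PadicAlgCl p)ˣ) ∧
        (g⁻¹ * ρ τ * g).val 3 3 = ((α τ)⁻¹ : (PadicAlgCl p)ˣ) := by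
  obtain ⟨g, α, β, hur, hdist, hsh⟩ := h
  refine ⟨g, α, β, hur, hdist, fun τ => ?_⟩
  obtain ⟨htri, -, -, h₀, h₁, h₂, h₃⟩ := hsh τ
  exact ⟨htri, h₀, h₁, h₂, h₃⟩

/-- The determinant of a `p`-distinguished weight-2 ordinary `ρ` is `ε²` (product of the diagonal
`εα · εβ · β⁻¹ · α⁻¹` of the conjugate upper-triangular matrix) — the square of the multiplier `ε`
of the homological convention. [folklore] -/
theorem IsWeightTwoOrdinaryDistinguished.coe_det_apply {ρ : FramedGaloisRep F (PadicAlgCl p) 4}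
    (h : IsWeightTwoOrdinaryDistinguished ρ) (τ : absoluteGaloisGroup F) :
    ((FramedRep.det ρ τ : (PadicAlgCl p)ˣ) : PadicAlgCl p) =
      algebraMap ℚ_[p] (PadicAlgCl p)
        (((GaloisRep.cyclotomicCharacter F p τ : ℤ_[p]ˣ) : ℤ_[p]) : ℚ_[p]) ^ 2 := by
  obtain ⟨g, α, β, -, -, hsh⟩ := h
  obtain ⟨htri, -, -, h₀, h₁, h₂, h₃⟩ := hsh τ
  have hdet : FramedRep.det ρ τ = Matrix.GeneralLinearGroup.det (g⁻¹ * ρ τ * g) := by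
    rw [FramedRep.det_apply, map_mul, map_mul, map_inv, inv_mul_cancel_comm]
  have hup : ((g⁻¹ * ρ τ * g : GL (Fin 4) (PadicAlgCl p)) :
      Matrix (Fin 4) (Fin 4) (PadicAlgCl p)).BlockTriangular id :=
    fun i j hij => htri i j hij
  rw [hdet, Matrix.GeneralLinearGroup.val_det_apply, Matrix.det_of_upperTriangular hup,
    Fin.prod_univ_four, h₀, h₁, h₂, h₃]
  set e : PadicAlgCl p := algebraMap ℚ_[p] (PadicAlgCl p)
    (((GaloisRep.cyclotomicCharacter F p τ : ℤ_[p]ˣ) : ℤ_[p]) : ℚ_[p]) with he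
  calc e * α τ * (e * β τ) * ((β τ)⁻¹ : (PadicAlgCl p)ˣ) * ((α τ)⁻¹ : (PadicAlgCl p)ˣ)
      = e ^ 2 * ((α τ : PadicAlgCl p) * ((α τ)⁻¹ : (PadicAlgCl p)ˣ)) *
          ((β τ : PadicAlgCl p) * ((β τ)⁻¹ : (PadicAlgCl p)ˣ)) := by ring
    _ = e ^ 2 := by rw [Units.mul_inv, Units.mul_inv, mul_one, mul_one]


/-- **Faithfulness certificate (cohomological ⇒ homological convention).**  Suppose
`ρ' : Γ_F → GL₄(ℚ̄_p)` has, in some frame `g`, the shape PRINTED by Boxer–Calegari–Gee–Pilloni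
(cohomological convention, similitude `ε⁻¹`): `g⁻¹ ρ'(τ) g` upper triangular with zeros at `(1,2)`
and `(3,4)` and diagonal `(α(τ), β(τ), ε(τ)⁻¹β(τ)⁻¹, ε(τ)⁻¹α(τ)⁻¹)`, `α, β` unramified and
residually distinct (`ε(τ)⁻¹` the image of the unit `ε(τ)⁻¹ ∈ ℤ_pˣ`).  Then the contragredient
`ρ'^∨ : τ ↦ (ρ'(τ)ᵀ)⁻¹` (accepted `FramedRep.dual`) is `IsWeightTwoOrdinaryDistinguished`, with the
same `α, β`, in the frame `(gᵀ)⁻¹ w`, `w` the order-reversing permutation matrix: the inverse of a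
block-upper-triangular matrix with diagonal `2 × 2` diagonal blocks is again of that form, with
inverted diagonal, and `w (·)ᵀ w` reverses the diagonal.  This is the translation asserted in the
docstring of `IsWeightTwoOrdinaryDistinguished` (`V_p(A) = ρ_{A,p}^∨`). [folklore] -/
theorem IsWeightTwoOrdinaryDistinguished.dual_of_cohomological
    {ρ' : FramedGaloisRep F (PadicAlgCl p) 4}
    (h : ∃ (g : Matrix.GeneralLinearGroup (Fin 4) (PadicAlgCl p))
      (α β : absoluteGaloisGroup F →* (PadicAlgCl p)ˣ),
      (∀ τ ∈ absInertia F, α τ = 1 ∧ β τ = 1) ∧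
      (∃ τ, Valued.v ((α τ : PadicAlgCl p) - β τ) = 1) ∧
      ∀ τ, (∀ i j : Fin 4, j < i → (g⁻¹ * ρ' τ * g).val i j = 0) ∧
        (g⁻¹ * ρ' τ * g).val 0 1 = 0 ∧ (g⁻¹ * ρ' τ * g).val 2 3 = 0 ∧
        (g⁻¹ * ρ' τ * g).val 0 0 = α τ ∧
        (g⁻¹ * ρ' τ * g).val 1 1 = β τ ∧
        (g⁻¹ * ρ' τ * g).val 2 2 =
          algebraMap ℚ_[p] (PadicAlgCl p)
            ((((GaloisRep.cyclotomicCharacter F p τ)⁻¹ : ℤ_[p]ˣ) : ℤ_[p]) : ℚ_[p]) *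
              ((β τ)⁻¹ : (PadicAlgCl p)ˣ) ∧
        (g⁻¹ * ρ' τ * g).val 3 3 =
          algebraMap ℚ_[p] (PadicAlgCl p)
            ((((GaloisRep.cyclotomicCharacter F p τ)⁻¹ : ℤ_[p]ˣ) : ℤ_[p]) : ℚ_[p]) *
              ((α τ)⁻¹ : (PadicAlgCl p)ˣ)) :
    IsWeightTwoOrdinaryDistinguished (FramedRep.dual ρ') := by
  obtain ⟨g, α, β, hur, hdist, hsh⟩ := h
  -- the order-reversing permutation matrix `w`, an involution, as an element `W` of `GL₄`
  have hrr : (Fin.revPerm.trans Fin.revPerm : Equiv.Perm (Fin 4)) = Equiv.refl (Fin 4) :=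
    Equiv.self_trans_symm _
  have hww : ((Fin.revPerm.toPEquiv.toMatrix : Matrix (Fin 4) (Fin 4) (PadicAlgCl p)) *
      Fin.revPerm.toPEquiv.toMatrix) = 1 := by
    rw [← PEquiv.toMatrix_trans, ← Equiv.toPEquiv_trans, hrr, Equiv.toPEquiv_refl,
      PEquiv.toMatrix_refl]
  let W : GL (Fin 4) (PadicAlgCl p) :=
    ⟨Fin.revPerm.toPEquiv.toMatrix, Fin.revPerm.toPEquiv.toMatrix, hww, hww⟩
  refine ⟨glTransposeInv (Fin 4) (PadicAlgCl p) g * W, α, β, hur, hdist, fun τ => ?_⟩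
  obtain ⟨htri, h01, h23, h0, h1, h2, h3⟩ := hsh τ
  set U : GL (Fin 4) (PadicAlgCl p) := g⁻¹ * ρ' τ * g with hU
  set V : Matrix (Fin 4) (Fin 4) (PadicAlgCl p) :=
    ((U⁻¹ : GL (Fin 4) (PadicAlgCl p)) : Matrix (Fin 4) (Fin 4) (PadicAlgCl p)) with hV
  set e' : PadicAlgCl p := algebraMap ℚ_[p] (PadicAlgCl p)
    ((((GaloisRep.cyclotomicCharacter F p τ)⁻¹ : ℤ_[p]ˣ) : ℤ_[p]) : ℚ_[p]) with he'
  set e : PadicAlgCl p := algebraMap ℚ_[p] (PadicAlgCl p)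
    (((GaloisRep.cyclotomicCharacter F p τ : ℤ_[p]ˣ) : ℤ_[p]) : ℚ_[p]) with he
  have hee' : e * e' = 1 := by
    rw [he, he', ← map_mul, ← PadicInt.coe_mul, ← Units.val_mul, mul_inv_cancel, Units.val_one,
      PadicInt.coe_one, map_one]
  have hαα : (α τ : PadicAlgCl p) * ((α τ)⁻¹ : (PadicAlgCl p)ˣ) = 1 := Units.mul_inv _
  have hββ : (β τ : PadicAlgCl p) * ((β τ)⁻¹ : (PadicAlgCl p)ˣ) = 1 := Units.mul_inv _
  -- in the chosen frame the contragredient is `w (U⁻¹)ᵀ w`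
  have hconj : (glTransposeInv (Fin 4) (PadicAlgCl p) g * W)⁻¹ * FramedRep.dual ρ' τ *
      (glTransposeInv (Fin 4) (PadicAlgCl p) g * W) =
        W⁻¹ * glTransposeInv (Fin 4) (PadicAlgCl p) U * W := by
    have hd : FramedRep.dual ρ' τ = glTransposeInv (Fin 4) (PadicAlgCl p) (ρ' τ) := rfl
    rw [hd, hU, map_mul, map_mul, map_inv]
    group
  have hN : ∀ i j, (W⁻¹ * glTransposeInv (Fin 4) (PadicAlgCl p) U * W).val i j =
      V (Fin.rev j) (Fin.rev i) := by
    intro i j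
    have hval : (W⁻¹ * glTransposeInv (Fin 4) (PadicAlgCl p) U * W).val =
        Fin.revPerm.toPEquiv.toMatrix * Vᵀ * Fin.revPerm.toPEquiv.toMatrix := rfl
    rw [hval, PEquiv.toMatrix_toPEquiv_mul, PEquiv.mul_toMatrix_toPEquiv]
    simp only [Matrix.submatrix_apply, Matrix.transpose_apply, id, Fin.revPerm_symm,
      Fin.revPerm_apply]
  -- `V = U⁻¹` is upper triangular
  have hUtri : ((U : GL (Fin 4) (PadicAlgCl p)) :
      Matrix (Fin 4) (Fin 4) (PadicAlgCl p)).BlockTriangular id :=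
    fun i j hij => htri i j hij
  have hVtri : V.BlockTriangular id := by
    rw [hV, Matrix.coe_units_inv]
    exact Matrix.blockTriangular_inv_of_blockTriangular hUtri
  have hV0 : ∀ i j : Fin 4, j < i → V i j = 0 := fun i j hij => hVtri hij
  -- the entries of `U * V = 1`
  have hUV : ((U : GL (Fin 4) (PadicAlgCl p)) : Matrix (Fin 4) (Fin 4) (PadicAlgCl p)) * V = 1 := by
    rw [hV, ← Units.val_mul, mul_inv_cancel, Units.val_one]
  have hent : ∀ i j : Fin 4,
      (U : Matrix (Fin 4) (Fin 4) (PadicAlgCl p)) i 0 * V 0 j +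
        (U : Matrix (Fin 4) (Fin 4) (PadicAlgCl p)) i 1 * V 1 j +
        (U : Matrix (Fin 4) (Fin 4) (PadicAlgCl p)) i 2 * V 2 j +
        (U : Matrix (Fin 4) (Fin 4) (PadicAlgCl p)) i 3 * V 3 j =
      (1 : Matrix (Fin 4) (Fin 4) (PadicAlgCl p)) i j := fun i j => by
    rw [← hUV, Matrix.mul_apply, Fin.sum_univ_four]
  have e01 : V 0 1 = 0 := by
    have h := hent 0 1
    rw [Matrix.one_apply_ne (by decide), h01, h0, hV0 2 1 (by decide), hV0 3 1 (by decide),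
      zero_mul, mul_zero, mul_zero, add_zero, add_zero, add_zero] at h
    exact (Units.mul_right_eq_zero _).mp h
  have e23 : V 2 3 = 0 := by
    have h := hent 2 3
    rw [Matrix.one_apply_ne (by decide), htri 2 0 (by decide), htri 2 1 (by decide), h23, h2,
      zero_mul, zero_mul, zero_mul, zero_add, zero_add, add_zero] at h
    exact (mul_eq_zero.mp h).resolve_left
      (mul_ne_zero (right_ne_zero_of_mul_eq_one hee') (Units.ne_zero _))
  have d0 : V 0 0 = ((α τ)⁻¹ : (PadicAlgCl p)ˣ) := by
    have h := hent 0 0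
    rw [Matrix.one_apply_eq, h0, hV0 1 0 (by decide), hV0 2 0 (by decide), hV0 3 0 (by decide),
      mul_zero, mul_zero, mul_zero, add_zero, add_zero, add_zero] at h
    exact (Units.inv_eq_of_mul_eq_one_right h).symm
  have d1 : V 1 1 = ((β τ)⁻¹ : (PadicAlgCl p)ˣ) := by
    have h := hent 1 1
    rw [Matrix.one_apply_eq, htri 1 0 (by decide), h1, hV0 2 1 (by decide), hV0 3 1 (by decide),
      zero_mul, mul_zero, mul_zero, zero_add, add_zero, add_zero] at h
    exact (Units.inv_eq_of_mul_eq_one_right h).symm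
  have d2 : V 2 2 = e * β τ := by
    have h := hent 2 2
    rw [Matrix.one_apply_eq, htri 2 0 (by decide), htri 2 1 (by decide), h2, hV0 3 2 (by decide),
      zero_mul, zero_mul, mul_zero, zero_add, zero_add, add_zero] at h
    linear_combination (e * (β τ : PadicAlgCl p)) * h
      - (V 2 2 * ((β τ : PadicAlgCl p) * ((β τ)⁻¹ : (PadicAlgCl p)ˣ))) * hee' - V 2 2 * hββ
  have d3 : V 3 3 = e * α τ := by
    have h := hent 3 3
    rw [Matrix.one_apply_eq, htri 3 0 (by decide), htri 3 1 (by decide), htri 3 2 (by decide), h3,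
      zero_mul, zero_mul, zero_mul, zero_add, zero_add, zero_add] at h
    linear_combination (e * (α τ : PadicAlgCl p)) * h
      - (V 3 3 * ((α τ : PadicAlgCl p) * ((α τ)⁻¹ : (PadicAlgCl p)ˣ))) * hee' - V 3 3 * hαα
  have r0 : Fin.rev (0 : Fin 4) = 3 := by decide
  have r1 : Fin.rev (1 : Fin 4) = 2 := by decide
  have r2 : Fin.rev (2 : Fin 4) = 1 := by decide
  have r3 : Fin.rev (3 : Fin 4) = 0 := by decide
  rw [hconj]
  refine ⟨fun i j hij => ?_, ?_, ?_, ?_, ?_, ?_, ?_⟩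
  · rw [hN]; exact hV0 _ _ (Fin.rev_lt_rev.mpr hij)
  · rw [hN, r0, r1]; exact e23
  · rw [hN, r2, r3]; exact e01
  · rw [hN, r0]; exact d3
  · rw [hN, r1]; exact d2
  · rw [hN, r2]; exact d1
  · rw [hN, r3]; exact d0

end FramedGaloisRep

end Local

/-! ### At a finite place of a number field -/

section Global

variable {K : Type*} [Field K] [NumberField K] {p : ℕ} [Fact p.Prime]

namespace FramedGaloisRep

/-- **`ρ : Γ_K → GL₄(ℚ̄_p)` is `p`-distinguished weight-2 ordinary at the finite place `v`** of the
number field `K` (intended `v ∣ p`): its restriction `ρ.toLocal v : Γ_{K_v} → GL₄(ℚ̄_p)` to the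
decomposition group (`K_v = v.adicCompletion K` with its non-archimedean local field structure) is
`IsWeightTwoOrdinaryDistinguished` — Boxer–Calegari–Gee–Pilloni's condition "for each place `v|p`,
`ρ_{A,p}|_{G_{F_v}}` is `p`-distinguished weight `2` ordinary" (a clause of their "good prime"),
in the homological convention.
[cite: BoxerEtAl2021, §7.3, Definition 7.3.1; §9.2, Definition 9.2.3 (good primes)] -/
def IsWeightTwoOrdinaryDistinguishedAt (ρ : FramedGaloisRep K (PadicAlgCl p) 4)
    (v : HeightOneSpectrum (𝓞 K)) : Prop :=
  IsWeightTwoOrdinaryDistinguished (ρ.toLocal v)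

/-- Unfolding of `IsWeightTwoOrdinaryDistinguishedAt` to the primitive vocabulary, in the binder
order of route PhantomRM (its inline clause plus the two zero conditions `(1,2)`, `(3,4)`).
[folklore] -/
theorem isWeightTwoOrdinaryDistinguishedAt_iff (ρ : FramedGaloisRep K (PadicAlgCl p) 4)
    (v : HeightOneSpectrum (𝓞 K)) :
    IsWeightTwoOrdinaryDistinguishedAt ρ v ↔
      ∃ (g : Matrix.GeneralLinearGroup (Fin 4) (PadicAlgCl p))
        (α β : absoluteGaloisGroup (v.adicCompletion K) →* (PadicAlgCl p)ˣ),
        (∀ τ ∈ absInertia (v.adicCompletion K), α τ = 1 ∧ β τ = 1) ∧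
        (∃ τ, Valued.v ((α τ : PadicAlgCl p) - β τ) = 1) ∧
        ∀ τ, (∀ i j : Fin 4, j < i → (g⁻¹ * ρ.toLocal v τ * g).val i j = 0) ∧
          (g⁻¹ * ρ.toLocal v τ * g).val 0 1 = 0 ∧ (g⁻¹ * ρ.toLocal v τ * g).val 2 3 = 0 ∧
          (g⁻¹ * ρ.toLocal v τ * g).val 0 0 =
            algebraMap ℚ_[p] (PadicAlgCl p)
              (((GaloisRep.cyclotomicCharacter (v.adicCompletion K) p τ : ℤ_[p]ˣ) : ℤ_[p]) :
                ℚ_[p]) * α τ ∧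
          (g⁻¹ * ρ.toLocal v τ * g).val 1 1 =
            algebraMap ℚ_[p] (PadicAlgCl p)
              (((GaloisRep.cyclotomicCharacter (v.adicCompletion K) p τ : ℤ_[p]ˣ) : ℤ_[p]) :
                ℚ_[p]) * β τ ∧
          (g⁻¹ * ρ.toLocal v τ * g).val 2 2 = ((β τ)⁻¹ : (PadicAlgCl p)ˣ) ∧
          (g⁻¹ * ρ.toLocal v τ * g).val 3 3 = ((α τ)⁻¹ : (PadicAlgCl p)ˣ) :=
  Iff.rfl

/-- `p`-distinguished weight-2 ordinarity at `v` is invariant under a global change of frame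
`ρ ↦ P ρ P⁻¹`. [folklore] -/
theorem isWeightTwoOrdinaryDistinguishedAt_conj_iff (P : GL (Fin 4) (PadicAlgCl p))
    (ρ : FramedGaloisRep K (PadicAlgCl p) 4) (v : HeightOneSpectrum (𝓞 K)) :
    IsWeightTwoOrdinaryDistinguishedAt (FramedRep.conj P ρ) v ↔
      IsWeightTwoOrdinaryDistinguishedAt ρ v := by
  rw [IsWeightTwoOrdinaryDistinguishedAt, toLocal_conj]
  exact isWeightTwoOrdinaryDistinguished_conj_iff P (ρ.toLocal v)

/-- (P) at `v` implies, verbatim, the Borel clause inlined in the items of route PhantomRM for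
`ρ.toLocal v` (drop the two zero conditions). [folklore] -/
theorem IsWeightTwoOrdinaryDistinguishedAt.exists_borel {ρ : FramedGaloisRep K (PadicAlgCl p) 4}
    {v : HeightOneSpectrum (𝓞 K)} (h : IsWeightTwoOrdinaryDistinguishedAt ρ v) :
    ∃ (g : Matrix.GeneralLinearGroup (Fin 4) (PadicAlgCl p))
      (α β : absoluteGaloisGroup (v.adicCompletion K) →* (PadicAlgCl p)ˣ),
      (∀ τ ∈ absInertia (v.adicCompletion K), α τ = 1 ∧ β τ = 1) ∧
      (∃ τ, Valued.v ((α τ : PadicAlgCl p) - β τ) = 1) ∧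
      ∀ τ, (∀ i j : Fin 4, j < i → (g⁻¹ * ρ.toLocal v τ * g).val i j = 0) ∧
        (g⁻¹ * ρ.toLocal v τ * g).val 0 0 =
          algebraMap ℚ_[p] (PadicAlgCl p)
            (((GaloisRep.cyclotomicCharacter (v.adicCompletion K) p τ : ℤ_[p]ˣ) : ℤ_[p]) :
              ℚ_[p]) * α τ ∧
        (g⁻¹ * ρ.toLocal v τ * g).val 1 1 =
          algebraMap ℚ_[p] (PadicAlgCl p)
            (((GaloisRep.cyclotomicCharacter (v.adicCompletion K) p τ : ℤ_[p]ˣ) : ℤ_[p]) :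
              ℚ_[p]) * β τ ∧
        (g⁻¹ * ρ.toLocal v τ * g).val 2 2 = ((β τ)⁻¹ : (PadicAlgCl p)ˣ) ∧
        (g⁻¹ * ρ.toLocal v τ * g).val 3 3 = ((α τ)⁻¹ : (PadicAlgCl p)ˣ) :=
  IsWeightTwoOrdinaryDistinguished.exists_borel h

end FramedGaloisRep

end Global

end Literature.NumberTheory.GaloisRepresentations
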